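import Summits.Ventures.PercRepro.S2LPCellP9D73
import Summits.Ventures.PercRepro.S2LPCellP8D73
import Summits.Ventures.PercRepro.S2LPPhi
import Summits.Ventures.PercRepro.S1RowNineAll
import Summits.Ventures.PercRepro.S1RowSevenAll
import Summits.Ventures.PercRepro.RankLevelSetPlaneTenPrime

/-!
# PercRepro — THE LEVEL-5 CELL `(9, 73)` OF THE `e`-FREE CORE, COLOOPS ALLOWED (p2's gen_wrap5.py run by p1 gen 42 on p1's exact certificates; chain cells beyond the LP reach by the hyperplane key, HyperplaneKeyDelete)

`c025_core_five_nine_seventythree`: every finite matroid of rank `9` on `82` points that is `e`-free satisfies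
`ThmN.RLS M 9 5` — the statement of SUBCLAIM-S2's cell `(9, 73)`. With `c` coloops the core `M ＼ M.coloops` is
the coloop-free cell `(9 − c, 73)` at the constant `(Φ(9,5) − 2(2^c − 1))/2^c`, below the natural constant of that row
(the cells `s2lp_*` of the rows `8 … 9`); `c ≥ 2` coloops retire the cell by the lossy ladder alone.
Nothing else is claimed.

* **`c025_core_five_nine_seventythree`**.
Axioms: standard.
-/

open scoped Matroid

namespace PercRepro

namespace S2LP

open Set Finset

variable {α : Type}

/-- **THE LEVEL-5 CELL `(9, 73)` OF THE `e`-FREE CORE** (SUBCLAIM-S2's form). -/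
theorem c025_core_five_nine_seventythree (M : Matroid α) [M.Finite] (hR : M.eRank = ((9 : ℕ) : ℕ∞))
    (hn : M.E.ncard = 9 + 73)
    (hfree : ∀ e ∈ M.E, ∃ A ⊆ M.E \ {e}, e ∉ M.closure A ∧ e ∉ M.closure ((M.E \ {e}) \ A)) :
    ThmN.RLS M 9 5 := by
  have hpairs := S1.pairs_of_free M hfree
  have hlines := S1.lines_of_free M hfree
  have hplanes := S1.planes_of_free M hfree
  have htens := S1.tens_of_free M hfree
  have hnineteen : ∀ X ⊆ M.E, M.eRk X ≤ 5 → X.ncard ≤ 19 :=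
    fun X hX h => ThmN.ncard_le_nineteen_of_eRk_le_five_of_free M hfree hX h
  have hn' : M.E.ncard = 82 := by rw [hn]
  have hKfin : M.coloops.Finite := M.ground_finite.subset M.coloops_subset_ground
  have hcases : M.coloops.ncard = 0 ∨ M.coloops.ncard = 1 ∨ 2 ≤ M.coloops.ncard := by omega
  rcases hcases with hc0 | hc1 | hbig
  · have hcol : M.coloops = ∅ := (ncard_eq_zero hKfin).1 hc0
    rw [ThmN.RLS_iff, phiK_nine_five]
    exact s2lp_9_82 M hR hn' hcol hpairs hlines hplanes htens hnineteen
  · -- `1` coloop: the core is the cell `(8, 73)`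
    have hR' : M.eRank = ((8 + 1 : ℕ) : ℕ∞) := by rw [hR]
    obtain ⟨hNR, hNn, hNcol, -, -⟩ := ladder_delete_coloops 1 M 8 5 hR' (by norm_num) (by norm_num) hc1
    rw [ThmN.RLS_iff, phiK_nine_five]
    refine phi_mul_topCount_le_of_delete_coloops M hR' (by norm_num) (by norm_num) hc1
      (κ := 8 / 3) (by norm_num) ?_
    exact s2lp_8_81 (M ＼ M.coloops) hNR (by omega) hNcol (pairs_delete M _ hpairs) (lines_delete M _ hlines)
      (fun X hX h => S1.size_delete hplanes _ X hX h) (fun X hX h => S1.size_delete htens _ X hX h)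
      (fun X hX h => S1.size_delete hnineteen _ X hX h)
  · -- `≥ 2` coloops: the lossy ladder alone
    have hΦ : phiK (7 + 2) 5 ≤ 2 * ((2 : ℚ) ^ 2 - 1) := by
      rw [show (7 + 2 : ℕ) = 9 from rfl, phiK_nine_five]; norm_num
    have h := S1.rls_of_coloops_lossy_q M (p := 7) (q := 5) (c := 2) hR (by norm_num) (by norm_num) hbig hΦ
    exact h

end S2LP

end PercRepro
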